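import Summits.QuantumFields.YangMills.Theorems.AlphaInputsT3ACv3SymAvgPlaqAssembly
import Summits.QuantumFields.YangMills.Theorems.AlphaInputsT3ACv3LinAvgIterFluxRigid
import Summits.QuantumFields.YangMills.Theorems.BalabanUVNodesN08AlphaRegSel
import HarnessLib

/-!
# `AlphaInputsT3ACv3SymAvgBlockSum69` — (O″χ) block B1, the (α) seam re-read as (69)_sym ∕ (71)_sym (★★OWNER RULING g26-№14 (c), R-ii): piece **(iv) TORUS → ℤ³ LETTERS**
# and **THE KNIT of (i) + (iii) + (iv)** — `|Ū^{(s)}(∂p′) − 1| ≤ blockSum (L^s) (L^s•zOf p′) μ ν (dev (liftCfg 𝔊 U) μ ν) + (13·(L^sδ)² + (4·324L(d+2)² + 52)·m_s²)` for a finest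
# field in the FLAT gauge (`‖U_b − 1‖ ≤ δ`), i.e. print's (69) for the SYMMETRIC (0.4)-average of record, in EXACTLY the `blockSum`∕`dev`∕`liftCfg` letters that ✓ `B10Eq70Squaring.ineq70_d3`
# ∕ ✓ `SmallFactor71Sym.smallFactor_of_large69(_unitary)` consume — lane `pub-balaban3d` ∕ cell `ym3-torus`, width seat `ym-ust-19936-w7` (g3)

WHY (cell `ym3-torus` bus 2026-08-28: ★★OWNER RULING g26-№14 (c) «the (71)_sym row per recorded plaquette from `large67RecSet ∧ reg68LocalSet` via (69)_sym = pieces (i)–(iv) +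
✓`ineq70_d3`»; LEAD ★w1-19936 g3 07:56:54Z target shape «`v_sym < blockSum (L^j) ((L^j:ℕ)•z₀) μ ν (dev (liftCfg U) μ ν) + b`, `b ≤ C₂·(g_jp)²`»; ★w6-19936 g2 LOCATE
`LOCATE-alpha-seam-w6-g2.md` §2).  Piece (i) (★w6 g2, ✓ `LinAvgIterFluxRigid.curl_iterLinAvg_eq_rigidFlux_offsets`) writes the curl of the `s`-fold linearised average around
`p′ = (y; μ, ν)` as `L^s·((L^s)^d·L^s)⁻¹·Σ_r Σ_{a,b<L^s} Y(∂□₁(z_{r,a,b}))` over the TORUS fine sites `z_{r,a,b} = runSite (runSite (fibreSite 0 s y r) μ a) ν b`; piece (iii) (this seat,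
✓ `SymAvgPlaqAssembly`) turns bond variables into plaquette variables at both ends.  The consumer side ((70)–(71), LQB `B10Eq70Squaring`, LEAD's ✓ `SmallFactor71Sym`) lives on
`ηℤ³`: `blockSum n x₀ μ ν F = Σ_r (n^d)⁻¹ Σ_{i,i'} F (corner n x₀ μ ν (r,i,i'))`, `corner = x₀ + boxVec n r + i•e_μ + i'•e_ν`, `x₀ = L^s • zOf p′` (✓ `TorusLift.zOf`), read through the lift
`dev (liftCfg 𝔊 U) μ ν y = dist1 (plaqVar U (projSite y) μ ν)` (✓ `N08AlphaRegSel.norm_hol_liftCfg_sub_one`).  THIS FILE supplies the index dictionary `projSite (corner …) = z_{r,a,b}`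
(§1), the resulting identity `blockSum ∘ dev ∘ liftCfg = ((L^s)^d)⁻¹ · Σ_r Σ_a Σ_b dist1 (plaqVar U z_{r,a,b} μ ν)` (§2), and the knit (§3).
WHAT (def-free).
* §1 (generic torus `P`): `projSite_add_natCast_smul_e` (`projSite (x + a•e_μ) = runSite (projSite x) μ a`), `projSite_nsmul_zOf_add_boxVec` (`projSite (L^s•zOf p + boxVec (L^s) r) =
  fibreSite 0 s p.src r`), ★ `projSite_corner` (the (69) index set of `B10Eq70Squaring` IS piece (i)'s offset index set, under `projSite`).
* §2 (any `Scales`∕`GroupModel`): `dev_liftCfg_corner`, ★ `blockSum_dev_liftCfg_eq`.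
* §3 (`SU(N)` on the tori of a `Scales`, flat gauge, binders EXACTLY those of ✓ `EMLIterUniform.norm_iter_sub_one_sub_iterLin_le_uniform` plus `δ ≤ 1`):
  ★★ `dist1_plaqHol_iter_le_tripleSum` (torus form, generic `P`: `|Ū^{(s)}(∂p′) − 1| ≤ ((L^s)^d)⁻¹·Σ_r Σ_a Σ_b ‖U(∂z_{r,a,b}) − 1‖ + 13·(L^sδ)² + (4·324L(d+2)² + 52)·m_s²`) and
  ★★★ `dist1_plaqHol_iter_le_blockSum` (LEAD's target letters: `… ≤ blockSum (L^s) ((L^s:ℕ)•zOf p′) p′.μ p′.ν (dev (liftCfg 𝔊 U) p′.μ p′.ν) + (13·(L^sδ)² + (4·324L(d+2)² + 52)·m_s²)`).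
  With `δ ≍ α₀·L^{−s}` (the box axial gauge of piece (ii), ★w2-19936 g4) both remainders are `O(α₀²)` and `s`-FREE — print's `b ≤ C₂(g_jp)²`.
HONEST FRAMING.  Lattice bookkeeping + the two landed pieces BY NAME; the gauge clamp that puts a READ-regular `Ũ` (`reg68LocalSet`, four blocks under `p′`) into the global flat gauge
assumed here (`hU`) is piece (ii), NOT here; nothing of [Balaban1985UV3] (69)–(71) is asserted beyond these letters; the seam row, B1, the stub `stub_laneRecordsV3Chi`, the crux
`HistoryTailL` and any gap are NOT closed; count-neutral helper (`--supports stmt-QuantumFields-19936`); registry untouched.  YM₃ on the three-torus is rung R3 of the programme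
(finite-torus SU(2)), not the Clay problem: nothing here is about d = 4, infinite volume, the continuum, or a mass gap.

References: T. Bałaban, Commun. Math. Phys. 102 (1985) 255–275 [Balaban1985UV3] ((67)–(71) p.273); Commun. Math. Phys. 98 (1985) 17–51 [Balaban1985Averaging] ((2) p.17, (9) p.19,
Prop. 1 (48)–(51) pp.25–26, Prop. 4 (134)–(135) p.38); Commun. Math. Phys. 95 (1984) 17–40 [Balaban1984PropagatorsI] ((1.18) p.20).
-/

set_option autoImplicit false

noncomputable section

open scoped Matrix.Norms.L2Operator BigOperators

namespace Summit.QuantumFields.YangMills.Theorems.SymAvgBlockSum69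

open Finset
open Literature.MathematicalPhysics.QuantumFieldTheory.Balaban1983to89
open Literature.MathematicalPhysics.QuantumFieldTheory.Balaban1985CMP102.Setting
open T4Continuum AveragingRT BlockAveraging ExpMeanLog BlockAveragingEMLLinearised LatticeFieldCalculus
open Summit.QuantumFields.Balaban3D.Proofs.LiftBridge (liftCfg)
open Summit.QuantumFields.Balaban3D.Proofs.TorusLift (projSite zOf projSite_add_e projSite_apply zOf_apply)
open Summit.QuantumFields.YangMills.Theorems.BalabanUVNodesN08AlphaRegSel (plaqVar norm_hol_liftCfg_sub_one)
open Summit.QuantumFields.YangMills.Theorems.SymAvgPlaqAssembly (dist1_plaqHol_iter_le_uniform norm_fineCurl_le_dist1_add)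
open Summit.QuantumFields.YangMills.Theorems.LinAvgIterFluxRigid (curl_iterLinAvg_eq_rigidFlux_offsets)
open Summit.QuantumFields.YangMills.Theorems.PerturbedPlaquette (dist1_SU_eq)

/-! ## §1 The (69) index set of `B10Eq70Squaring` under `projSite` is piece (i)'s offset index set -/

section Dictionary

variable {P : Params}

/-- `projSite (x + a•e_μ) = runSite (projSite x) μ a`: integer steps project to torus steps. [cite: Balaban1984PropagatorsI, (1.18) p.20] -/
theorem projSite_add_natCast_smul_e (x : B7Prop1Explicit.Site P.d) (μ : Fin P.d) :
    ∀ a : ℕ, projSite (P := P) (x + ((a : ℕ) : ℤ) • B7Prop1Explicit.e μ) = runSite (projSite x) μ a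
  | 0 => by rw [Nat.cast_zero, zero_smul, add_zero, runSite_zero]
  | a + 1 => by
    rw [Nat.cast_succ, add_smul, one_smul, ← add_assoc, projSite_add_e, projSite_add_natCast_smul_e x μ a, runSite_succ]

/-- `projSite (L^s•zOf p + boxVec (L^s) r) = fibreSite 0 s p.src r`: the integer block point `x₀ + r` of (69) (`x₀ = L^s·z₀`, `z₀` the labels of the coarse corner) projects to the
fine torus site of offset `r` over `p.src`. [cite: Balaban1985Averaging, (2) p.17; Balaban1984PropagatorsI, (1.18) p.20] -/
theorem projSite_nsmul_zOf_add_boxVec {s : ℕ} (p : Plaq P s) (r : Fin P.d → Fin (P.L ^ s)) :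
    projSite (P := P) ((P.L ^ s : ℕ) • zOf p + B7Prop1Explicit.boxVec (P.L ^ s) r) = Site.fibreSite 0 s p.src r := by
  funext κ
  simp only [projSite_apply, Pi.add_apply, Pi.smul_apply, zOf_apply, B7Prop1Explicit.boxVec, Site.fibreSite]
  rw [nsmul_eq_mul]
  push_cast
  ring

/-- **★ THE INDEX DICTIONARY**: the sub-plaquette corner `corner (L^s) (L^s•zOf p) μ ν (r, a, b) = L^s•zOf p + r + a e_μ + b e_ν` of `B10Eq70Squaring` projects to piece (i)'s torus fine site
`runSite (runSite (fibreSite 0 s p.src r) μ a) ν b`. [cite: Balaban1985UV3, (69) p.273; Balaban1984PropagatorsI, (1.18) p.20] -/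
theorem projSite_corner {s : ℕ} (p : Plaq P s) (μ ν : Fin P.d) (t : B10Eq70Squaring.Idx P.d (P.L ^ s)) :
    projSite (P := P) (B10Eq70Squaring.corner (P.L ^ s) ((P.L ^ s : ℕ) • zOf p) μ ν t) =
      runSite (runSite (Site.fibreSite 0 s p.src t.1) μ t.2.1) ν t.2.2 := by
  unfold B10Eq70Squaring.corner
  rw [projSite_add_natCast_smul_e, projSite_add_natCast_smul_e, projSite_nsmul_zOf_add_boxVec]

end Dictionary

/-! ## §2 `blockSum ∘ dev ∘ liftCfg` is the torus triple sum of plaquette deviations -/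

section Lift

variable {L : ℕ} {S : Scales L} {G : Type} [GaugeGroup G] [MeasurableSpace G] (𝔊 : GroupModel G)

/-- The lift's plaquette deviation at a sub-plaquette corner of (69) is the torus plaquette deviation at piece (i)'s fine site. [cite: Balaban1985UV3, (68)–(69) p.273] -/
theorem dev_liftCfg_corner {s : ℕ} (p : Plaq S.P s) (μ ν : Fin S.P.d) (U : GaugeField S.P 0 G) (t : B10Eq70Squaring.Idx S.P.d (S.P.L ^ s)) :
    B10Eq70Squaring.dev (liftCfg 𝔊 U) μ ν (B10Eq70Squaring.corner (S.P.L ^ s) ((S.P.L ^ s : ℕ) • zOf p) μ ν t) =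
      dist1 (plaqVar U (runSite (runSite (Site.fibreSite 0 s p.src t.1) μ t.2.1) ν t.2.2) μ ν) := by
  unfold B10Eq70Squaring.dev
  rw [norm_hol_liftCfg_sub_one, projSite_corner]

/-- **★ `blockSum ∘ dev ∘ liftCfg` READ ON THE TORUS**: `blockSum (L^s) (L^s•zOf p) μ ν (dev (liftCfg 𝔊 U) μ ν) = ((L^s)^d)⁻¹ · Σ_r Σ_{a<L^s} Σ_{b<L^s} dist1 (plaqVar U z_{r,a,b} μ ν)`,
`z_{r,a,b} = runSite (runSite (fibreSite 0 s p.src r) μ a) ν b` — the right-hand side of LEAD's target in piece (i)'s index letters. [cite: Balaban1985UV3, (69) p.273] -/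
theorem blockSum_dev_liftCfg_eq {s : ℕ} (p : Plaq S.P s) (μ ν : Fin S.P.d) (U : GaugeField S.P 0 G) :
    B10Eq70Squaring.blockSum (S.P.L ^ s) ((S.P.L ^ s : ℕ) • zOf p) μ ν (B10Eq70Squaring.dev (liftCfg 𝔊 U) μ ν) =
      (((S.P.L : ℝ) ^ s) ^ S.P.d)⁻¹ *
        ∑ r : Fin S.P.d → Fin (S.P.L ^ s), ∑ a ∈ range (S.P.L ^ s), ∑ b ∈ range (S.P.L ^ s),
          dist1 (plaqVar U (runSite (runSite (Site.fibreSite 0 s p.src r) μ a) ν b) μ ν) := by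
  rw [B10Eq70Squaring.blockSum_eq, Finset.mul_sum]
  have hn : (((S.P.L ^ s : ℕ) : ℝ) ^ S.P.d)⁻¹ = (((S.P.L : ℝ) ^ s) ^ S.P.d)⁻¹ := by push_cast; ring
  refine Finset.sum_congr rfl fun r _ => ?_
  rw [hn]
  congr 1
  rw [Finset.sum_range (fun a => ∑ b ∈ range (S.P.L ^ s), dist1 (plaqVar U (runSite (runSite (Site.fibreSite 0 s p.src r) μ a) ν b) μ ν))]
  refine Finset.sum_congr rfl fun a _ => ?_
  rw [Finset.sum_range (fun b => dist1 (plaqVar U (runSite (runSite (Site.fibreSite 0 s p.src r) μ a) ν b) μ ν))]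
  refine Finset.sum_congr rfl fun b _ => ?_
  exact dev_liftCfg_corner 𝔊 p μ ν U (r, a, b)

end Lift

/-! ## §3 The knit: (69) for the symmetric (0.4)-average of record at the flat gauge -/

section Knit

variable {P : Params} {n : Type*} [Fintype n] [DecidableEq n] [Nonempty n]

/-- `runSite x μ 1 = x + e_μ`. [folklore] -/
private theorem runSite_one' {j : ℕ} (x : Site P j) (μ : Fin P.d) : runSite x μ 1 = x.shift μ := by
  rw [show (1 : ℕ) = 0 + 1 from rfl, runSite_succ, runSite_zero]

/-- **★★ (69)_sym, TORUS FORM** (generic torus `P`, generic `SU(N)`, flat gauge).  Under EXACTLY the binders of ✓ `EMLIterUniform.norm_iter_sub_one_sub_iterLin_le_uniform` (`Q` with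
`Q 0 = id`, `Q (s+1) Y c = linAvg (Q s Y) c`; `d + 2 ≤ L`; `‖U_b − 1‖ ≤ δ` everywhere; the ONE window on `m_k`) plus `δ ≤ 1`, for every `s ≤ k` in the standing range and every plaquette
`p′ : Plaq P s`:  `|Ū^{(s)}(∂p′) − 1| ≤ ((L^s)^d)⁻¹ · Σ_r Σ_{a,b<L^s} ‖U(∂z_{r,a,b}) − 1‖ + 13·(L^sδ)² + (4·324L(d+2)² + 52)·m_s²`, `z_{r,a,b} = runSite (runSite (fibreSite 0 s p′.src r) μ a) ν b`,
`m_s = 2|n|²(d+1)L^sδ` — pieces (iii) (`dist1_plaqHol_iter_le_uniform`, `norm_fineCurl_le_dist1_add`) and (i) (`curl_iterLinAvg_eq_rigidFlux_offsets`) BY NAME.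
[cite: Balaban1985UV3, (69) p.273; Balaban1985Averaging, Prop. 1 (48)–(51) pp.25–26, Prop. 4 (134)–(135) p.38] -/
theorem dist1_plaqHol_iter_le_tripleSum
    (Q : (i : ℕ) → (PBond P 0 → Matrix n n ℂ) → PBond P i → Matrix n n ℂ)
    (hQ0 : ∀ Y, Q 0 Y = Y) (hQs : ∀ (i : ℕ) (Y : PBond P 0 → Matrix n n ℂ) (c : PBond P (i + 1)), Q (i + 1) Y c = linAvg (Q i Y) c)
    (hL : P.d + 2 ≤ P.L) (U : GaugeField P 0 (Matrix.specialUnitaryGroup n ℂ)) {δ : ℝ} (hδ : 0 ≤ δ) (hδ1 : δ ≤ 1)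
    (hU : ∀ b, ‖((U b : Matrix.specialUnitaryGroup n ℂ) : Matrix n n ℂ) - 1‖ ≤ δ) (k : ℕ)
    (hm : 324 * (P.L : ℝ) * ((P.d : ℝ) + 2) ^ 2 * (2 * (Fintype.card n : ℝ) ^ 2 * (((P.d : ℝ) + 1) * (P.L : ℝ) ^ k * δ)) ≤ 1)
    (hN : 4 * (((P.d + 2) * P.L : ℕ) : ℝ) * (2 * (Fintype.card n : ℝ) ^ 2 * (((P.d : ℝ) + 1) * (P.L : ℝ) ^ k * δ)) < deltaSU n)
    (s : ℕ) (hs : s ≤ k) (hsK : s ≤ P.m + P.K) (p : Plaq P s) :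
    GaugeGroup.dist1 (GaugeField.plaqHol (Averaging.iter (fun i => blockAvg (P := P) (j := i) (expMeanLogSU (n := n))) s U) p) ≤
      (((P.L : ℝ) ^ s) ^ P.d)⁻¹ *
        (∑ r : Fin P.d → Fin (P.L ^ s), ∑ a ∈ range (P.L ^ s), ∑ b ∈ range (P.L ^ s),
          ‖((U ⟨runSite (runSite (Site.fibreSite 0 s p.src r) p.μ a) p.ν b, p.μ⟩ *
              U ⟨(runSite (runSite (Site.fibreSite 0 s p.src r) p.μ a) p.ν b).shift p.μ, p.ν⟩ *
              (U ⟨(runSite (runSite (Site.fibreSite 0 s p.src r) p.μ a) p.ν b).shift p.ν, p.μ⟩)⁻¹ *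
              (U ⟨runSite (runSite (Site.fibreSite 0 s p.src r) p.μ a) p.ν b, p.ν⟩)⁻¹ : Matrix.specialUnitaryGroup n ℂ) : Matrix n n ℂ) - 1‖) +
      13 * ((P.L : ℝ) ^ s * δ) ^ 2 +
      (4 * (324 * (P.L : ℝ) * ((P.d : ℝ) + 2) ^ 2) + 52) * (2 * (Fintype.card n : ℝ) ^ 2 * (((P.d : ℝ) + 1) * (P.L : ℝ) ^ s * δ)) ^ 2 := by
  -- letters
  set Y : PBond P 0 → Matrix n n ℂ := fun b => ((U b : Matrix.specialUnitaryGroup n ℂ) : Matrix n n ℂ) - 1 with hY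
  set N : ℕ := P.L ^ s with hNdef
  set z : (Fin P.d → Fin N) → ℕ → ℕ → Site P 0 := fun r a b => runSite (runSite (Site.fibreSite 0 s p.src r) p.μ a) p.ν b with hz
  have hL0 : (0 : ℝ) < P.L := Nat.cast_pos.mpr P.L_pos
  have hLs : (0 : ℝ) < (P.L : ℝ) ^ s := pow_pos hL0 s
  have hNr : (N : ℝ) = (P.L : ℝ) ^ s := by rw [hNdef, Nat.cast_pow]
  -- piece (iii), coarse end
  have h1 := dist1_plaqHol_iter_le_uniform Q hQ0 hQs hL U hδ hU k hm hN s hs p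
  -- piece (i): the curl of `Q^{(s)}Y` is the rigid flux
  have hflux := curl_iterLinAvg_eq_rigidFlux_offsets Q hQ0 hQs hsK Y p.src p.μ p.ν
  -- piece (iii), fine end: every unit circulation is the plaquette deviation to second order
  have hfine : ∀ (r : Fin P.d → Fin N) (a b : ℕ),
      ‖Y ⟨z r a b, p.μ⟩ + Y ⟨runSite (z r a b) p.μ 1, p.ν⟩ - Y ⟨runSite (z r a b) p.ν 1, p.μ⟩ - Y ⟨z r a b, p.ν⟩‖ ≤
        ‖((U ⟨z r a b, p.μ⟩ * U ⟨(z r a b).shift p.μ, p.ν⟩ * (U ⟨(z r a b).shift p.ν, p.μ⟩)⁻¹ * (U ⟨z r a b, p.ν⟩)⁻¹ :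
            Matrix.specialUnitaryGroup n ℂ) : Matrix n n ℂ) - 1‖ + 13 * δ ^ 2 := by
    intro r a b
    rw [runSite_one', runSite_one']
    exact norm_fineCurl_le_dist1_add U (z r a b) p.μ p.ν hδ1 (hU _) (hU _) (hU _) (hU _)
  -- the norm of the rigid flux
  have hsum : ‖∑ r : Fin P.d → Fin N, ∑ a ∈ range N, ∑ b ∈ range N,
        (Y ⟨z r a b, p.μ⟩ + Y ⟨runSite (z r a b) p.μ 1, p.ν⟩ - Y ⟨runSite (z r a b) p.ν 1, p.μ⟩ - Y ⟨z r a b, p.ν⟩)‖ ≤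
      (∑ r : Fin P.d → Fin N, ∑ a ∈ range N, ∑ b ∈ range N,
        ‖((U ⟨z r a b, p.μ⟩ * U ⟨(z r a b).shift p.μ, p.ν⟩ * (U ⟨(z r a b).shift p.ν, p.μ⟩)⁻¹ * (U ⟨z r a b, p.ν⟩)⁻¹ :
            Matrix.specialUnitaryGroup n ℂ) : Matrix n n ℂ) - 1‖) + (N : ℝ) ^ P.d * ((N : ℝ) * ((N : ℝ) * (13 * δ ^ 2))) := by
    refine (norm_sum_le _ _).trans ?_
    have hr : ∀ r : Fin P.d → Fin N, ‖∑ a ∈ range N, ∑ b ∈ range N,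
          (Y ⟨z r a b, p.μ⟩ + Y ⟨runSite (z r a b) p.μ 1, p.ν⟩ - Y ⟨runSite (z r a b) p.ν 1, p.μ⟩ - Y ⟨z r a b, p.ν⟩)‖ ≤
        (∑ a ∈ range N, ∑ b ∈ range N,
          ‖((U ⟨z r a b, p.μ⟩ * U ⟨(z r a b).shift p.μ, p.ν⟩ * (U ⟨(z r a b).shift p.ν, p.μ⟩)⁻¹ * (U ⟨z r a b, p.ν⟩)⁻¹ :
              Matrix.specialUnitaryGroup n ℂ) : Matrix n n ℂ) - 1‖) + (N : ℝ) * ((N : ℝ) * (13 * δ ^ 2)) := by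
      intro r
      refine (norm_sum_le _ _).trans ?_
      have ha : ∀ a ∈ range N, ‖∑ b ∈ range N,
            (Y ⟨z r a b, p.μ⟩ + Y ⟨runSite (z r a b) p.μ 1, p.ν⟩ - Y ⟨runSite (z r a b) p.ν 1, p.μ⟩ - Y ⟨z r a b, p.ν⟩)‖ ≤
          (∑ b ∈ range N,
            ‖((U ⟨z r a b, p.μ⟩ * U ⟨(z r a b).shift p.μ, p.ν⟩ * (U ⟨(z r a b).shift p.ν, p.μ⟩)⁻¹ * (U ⟨z r a b, p.ν⟩)⁻¹ :
                Matrix.specialUnitaryGroup n ℂ) : Matrix n n ℂ) - 1‖) + (N : ℝ) * (13 * δ ^ 2) := by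
        intro a _
        refine (norm_sum_le _ _).trans ?_
        have := Finset.sum_le_sum (s := range N) fun b _ => hfine r a b
        refine this.trans (le_of_eq ?_)
        rw [Finset.sum_add_distrib, Finset.sum_const, Finset.card_range, nsmul_eq_mul]
      refine (Finset.sum_le_sum ha).trans (le_of_eq ?_)
      rw [Finset.sum_add_distrib, Finset.sum_const, Finset.card_range, nsmul_eq_mul]
    refine (Finset.sum_le_sum fun r _ => hr r).trans (le_of_eq ?_)
    rw [Finset.sum_add_distrib, Finset.sum_const, Finset.card_univ, Fintype.card_fun, Fintype.card_fin, Fintype.card_fin, nsmul_eq_mul]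
    push_cast
    ring
  -- the curl's norm: `L^s · ((L^s)^d L^s)⁻¹ = ((L^s)^d)⁻¹`
  have hw : (P.L : ℝ) ^ s * ((((P.L : ℝ) ^ s) ^ P.d * (P.L : ℝ) ^ s)⁻¹) = (((P.L : ℝ) ^ s) ^ P.d)⁻¹ := by
    field_simp
  have hcurl : ‖Q s Y ⟨p.src, p.μ⟩ + Q s Y ⟨p.src.shift p.μ, p.ν⟩ - Q s Y ⟨p.src.shift p.ν, p.μ⟩ - Q s Y ⟨p.src, p.ν⟩‖ ≤
      (((P.L : ℝ) ^ s) ^ P.d)⁻¹ *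
        (∑ r : Fin P.d → Fin N, ∑ a ∈ range N, ∑ b ∈ range N,
          ‖((U ⟨z r a b, p.μ⟩ * U ⟨(z r a b).shift p.μ, p.ν⟩ * (U ⟨(z r a b).shift p.ν, p.μ⟩)⁻¹ * (U ⟨z r a b, p.ν⟩)⁻¹ :
              Matrix.specialUnitaryGroup n ℂ) : Matrix n n ℂ) - 1‖) + 13 * ((P.L : ℝ) ^ s * δ) ^ 2 := by
    rw [hflux, norm_smul, norm_smul, norm_pow, Complex.norm_natCast, norm_inv, Real.norm_eq_abs, abs_of_pos (by positivity)]
    have hd : (0 : ℝ) ≤ (((P.L : ℝ) ^ s) ^ P.d)⁻¹ := by positivity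
    calc (P.L : ℝ) ^ s * ((((P.L : ℝ) ^ s) ^ P.d * (P.L : ℝ) ^ s)⁻¹ * ‖_‖)
        = (((P.L : ℝ) ^ s) ^ P.d)⁻¹ * ‖∑ r : Fin P.d → Fin N, ∑ a ∈ range N, ∑ b ∈ range N,
            (Y ⟨z r a b, p.μ⟩ + Y ⟨runSite (z r a b) p.μ 1, p.ν⟩ - Y ⟨runSite (z r a b) p.ν 1, p.μ⟩ - Y ⟨z r a b, p.ν⟩)‖ := by
          rw [← mul_assoc, hw]
      _ ≤ (((P.L : ℝ) ^ s) ^ P.d)⁻¹ * ((∑ r : Fin P.d → Fin N, ∑ a ∈ range N, ∑ b ∈ range N,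
            ‖((U ⟨z r a b, p.μ⟩ * U ⟨(z r a b).shift p.μ, p.ν⟩ * (U ⟨(z r a b).shift p.ν, p.μ⟩)⁻¹ * (U ⟨z r a b, p.ν⟩)⁻¹ :
                Matrix.specialUnitaryGroup n ℂ) : Matrix n n ℂ) - 1‖) + (N : ℝ) ^ P.d * ((N : ℝ) * ((N : ℝ) * (13 * δ ^ 2)))) :=
          mul_le_mul_of_nonneg_left hsum hd
      _ = _ := by
          rw [hNr, mul_add, ← mul_assoc ((((P.L : ℝ) ^ s) ^ P.d)⁻¹), inv_mul_cancel₀ (pow_ne_zero _ hLs.ne'), one_mul]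
          ring
  linarith

variable {L : ℕ} {S : Scales L}

/-- **★★★ (69)_sym IN THE (70)–(71) LETTERS** (LEAD ★w1-19936 g3's target shape; `SU(N)` on the tori of a `Scales`, any `GroupModel` reading, flat gauge): under the binders of
`dist1_plaqHol_iter_le_tripleSum`, for every `s ≤ k` in the standing range and every `p′ : Plaq S.P s`,
`|Ū^{(s)}(∂p′) − 1| ≤ blockSum (L^s) ((L^s:ℕ)•zOf p′) p′.μ p′.ν (dev (liftCfg 𝔊 U) p′.μ p′.ν) + (13·(L^sδ)² + (4·324L(d+2)² + 52)·m_s²)` — the large quantity of (67) in RECORDING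
currency bounded by print's block sum (69) of the LIFT's fine plaquette deviations plus a remainder quadratic on the natural scale (`= b`, to be bounded by `C₂(g_jp)²` on the record's
window).  Feeds ✓ `B10Eq70Squaring.ineq70_d3` ∕ ✓ `SmallFactor71Sym.smallFactor_of_large69_unitary` as their `h69`. [cite: Balaban1985UV3, (67)–(69) p.273; Balaban1985Averaging, Prop. 4 (134)–(135) p.38] -/
theorem dist1_plaqHol_iter_le_blockSum {N : ℕ} [NeZero N] (𝔊 : GroupModel (Matrix.specialUnitaryGroup (Fin N) ℂ))
    (Q : (i : ℕ) → (PBond S.P 0 → Matrix (Fin N) (Fin N) ℂ) → PBond S.P i → Matrix (Fin N) (Fin N) ℂ)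
    (hQ0 : ∀ Y, Q 0 Y = Y) (hQs : ∀ (i : ℕ) (Y : PBond S.P 0 → Matrix (Fin N) (Fin N) ℂ) (c : PBond S.P (i + 1)), Q (i + 1) Y c = linAvg (Q i Y) c)
    (hL : S.P.d + 2 ≤ S.P.L) (U : GaugeField S.P 0 (Matrix.specialUnitaryGroup (Fin N) ℂ)) {δ : ℝ} (hδ : 0 ≤ δ) (hδ1 : δ ≤ 1)
    (hU : ∀ b, ‖((U b : Matrix.specialUnitaryGroup (Fin N) ℂ) : Matrix (Fin N) (Fin N) ℂ) - 1‖ ≤ δ) (k : ℕ)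
    (hm : 324 * (S.P.L : ℝ) * ((S.P.d : ℝ) + 2) ^ 2 * (2 * (Fintype.card (Fin N) : ℝ) ^ 2 * (((S.P.d : ℝ) + 1) * (S.P.L : ℝ) ^ k * δ)) ≤ 1)
    (hN : 4 * (((S.P.d + 2) * S.P.L : ℕ) : ℝ) * (2 * (Fintype.card (Fin N) : ℝ) ^ 2 * (((S.P.d : ℝ) + 1) * (S.P.L : ℝ) ^ k * δ)) < deltaSU (Fin N))
    (s : ℕ) (hs : s ≤ k) (hsK : s ≤ S.P.m + S.P.K) (p : Plaq S.P s) :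
    GaugeGroup.dist1 (GaugeField.plaqHol (Averaging.iter (fun i => blockAvg (P := S.P) (j := i) (expMeanLogSU (n := Fin N))) s U) p) ≤
      B10Eq70Squaring.blockSum (S.P.L ^ s) ((S.P.L ^ s : ℕ) • zOf p) p.μ p.ν (B10Eq70Squaring.dev (liftCfg 𝔊 U) p.μ p.ν) +
      (13 * ((S.P.L : ℝ) ^ s * δ) ^ 2 +
        (4 * (324 * (S.P.L : ℝ) * ((S.P.d : ℝ) + 2) ^ 2) + 52) * (2 * (Fintype.card (Fin N) : ℝ) ^ 2 * (((S.P.d : ℝ) + 1) * (S.P.L : ℝ) ^ s * δ)) ^ 2) := by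
  have h := dist1_plaqHol_iter_le_tripleSum Q hQ0 hQs hL U hδ hδ1 hU k hm hN s hs hsK p
  rw [blockSum_dev_liftCfg_eq 𝔊 p p.μ p.ν U]
  have e : ∀ (r : Fin S.P.d → Fin (S.P.L ^ s)) (a b : ℕ),
      GaugeGroup.dist1 (plaqVar U (runSite (runSite (Site.fibreSite 0 s p.src r) p.μ a) p.ν b) p.μ p.ν) =
        ‖((U ⟨runSite (runSite (Site.fibreSite 0 s p.src r) p.μ a) p.ν b, p.μ⟩ *
            U ⟨(runSite (runSite (Site.fibreSite 0 s p.src r) p.μ a) p.ν b).shift p.μ, p.ν⟩ *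
            (U ⟨(runSite (runSite (Site.fibreSite 0 s p.src r) p.μ a) p.ν b).shift p.ν, p.μ⟩)⁻¹ *
            (U ⟨runSite (runSite (Site.fibreSite 0 s p.src r) p.μ a) p.ν b, p.ν⟩)⁻¹ : Matrix.specialUnitaryGroup (Fin N) ℂ) :
            Matrix (Fin N) (Fin N) ℂ) - 1‖ := fun r a b => by
    rw [dist1_SU_eq]; rfl
  simp only [e]
  linarith

end Knit

end Summit.QuantumFields.YangMills.Theorems.SymAvgBlockSum69

end
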